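import Literature.Probability.Percolation.DecisionTreeBowtieMeasure
import Literature.Probability.Percolation.BridgeSharingPaths
import Literature.Probability.Percolation.PercolationEvents
import HarnessLib

/-!
# `NoHeavyLowerTail` (stmt-CriticalPhenomena-4575) — support file: THEOREM A* of the crux notes
# ("Harris loses at most the bridge factor") for the Gladkov–Zimin covariance `Cov(1{a↔c},1{b↔c})`

Support file (`--supports stmt-CriticalPhenomena-4575`; closes nothing; no definitions, no named facts, no sorries),
prover `prim-ineq-prove-2` gen 9 (MEMO-14 §2c, MEMO-18).  Companion of the THEOREM B package
(`PercNearOneGluingNoHeavyLowerTailGZHub*.lean`: the Gladkov–Zimin Conjecture 6.3 / Gladkov Conjecture 10.1 for hubs of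
bounded isolation probability).  Here the covariance is bounded by the BRIDGE FRAGILITY of the `a–b–c` cluster:

* `GZBridge.integral_bridgeProduct_le` (**THEOREM A\***): on every finite weighted graph and all vertices `a, b, c`,
  `E[ 1{a↔c ∧ b↔c} · ∏_{e ∈ Br(c|ab)} w_e ] ≤ P(a↔c)·P(b↔c)`, where `Br(c|ab)(ω)` is the set of OPEN edges whose deletion
  separates `c` from `a` and from `b` (the open `c|ab`-bridges; `Literature.Combinatorics.SimpleGraph.SepEdge`).
  Proof: the two open paths `a → c`, `b → c` sharing exactly `Br(c|ab)` (`exists_open_paths_inter_edges_sepEdge`, edge-Menger)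
  are witnesses for Gladkov's two-configuration Theorem 8.2 at the measure level
  (`integral_indicator_mul_prod_le_of_witnesses`, "Harris loses at most the overlap factor").
* `GZBridge.cov_le_integral_bridgeDefect`: `P(a↔c↔b) − P(a↔c)P(b↔c) ≤ E[1{a↔c↔b}·(1 − ∏_{Br} w_e)]`;
* `GZBridge.cov_le_real_exists_bridge`: `Cov ≤ P(a↔c↔b ∧ Br(c|ab) ≠ ∅)` — all of the positive correlation of `{a↔c}`,
  `{b↔c}` is carried by configurations in which `c` hangs off the `ab`-cluster through an open bridge;
* `GZBridge.cov_le_integral_bridgeSum` (THEOREM A, bridge form): `Cov ≤ E[1{a↔c↔b}·∑_{e∈Br}(1 − w_e)]`.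
[cite: Gladkov2024, Thm. 8.2 and p. 14] [cite: GladkovZimin2024, §6 (Conj. 6.3, Prop. 6.1)]
-/

noncomputable section

namespace Summit.CriticalPhenomena.PercolationContinuityZ3.Theorems

open MeasureTheory Finset Literature.Probability.LatticeModels Literature.Probability.Percolation
open Literature.Combinatorics.SimpleGraph (SepEdge)
open scoped Classical

namespace GZBridge

variable {V : Type*} [Fintype V]

omit [Fintype V] in
/-- An open path, read in the configuration consisting of its own edges, still joins its endpoints. [folklore] -/
private theorem reachable_openGraph_edges {ω : Set (Sym2 V)} {x y : V} (p : (openGraph ω).Walk x y) :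
    (openGraph {e : Sym2 V | e ∈ p.edges}).Reachable x y := by
  refine ⟨p.transfer (openGraph {e : Sym2 V | e ∈ p.edges}) fun e he => ?_⟩
  have hnd : ¬ e.IsDiag := SimpleGraph.not_isDiag_of_mem_edgeSet _ (p.edges_subset_edgeSet he)
  unfold openGraph
  rw [SimpleGraph.edgeSet_fromEdgeSet]
  exact ⟨he, fun hd => hnd (Sym2.mem_diagSet.1 hd)⟩

/-- **THEOREM A\*** ("Harris loses at most the bridge factor"): for Bernoulli bond percolation with arbitrary edge weights
on a finite graph and vertices `a, b, c`,  `E[1{a↔c ∧ b↔c} · ∏_{e ∈ Br(c|ab)} w_e] ≤ P(a↔c)·P(b↔c)`, `Br(c|ab)(ω)` = the open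
edges separating `c` from both `a` and `b`.  (Gladkov's Theorem 8.2 with the witnesses of `exists_open_paths_inter_edges_sepEdge`.)
[cite: Gladkov2024, Thm. 8.2 and p. 14] -/
theorem integral_bridgeProduct_le (w : Sym2 V → unitInterval) (a b c : V) :
    ∫ ω, ((openConn a c : Set (Set (Sym2 V))) ∩ (openConn b c : Set (Set (Sym2 V)))).indicator (fun _ => (1 : ℝ)) ω *
        ∏ e ∈ univ.filter (fun e => SepEdge (openGraph ω) c a e ∧ SepEdge (openGraph ω) c b e), (w e : ℝ)
        ∂(prodBernoulli w) ≤
      (prodBernoulli w).real (openConn a c) * (prodBernoulli w).real (openConn b c) := by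
  refine integral_indicator_mul_prod_le_of_witnesses w (isUpperSet_openConn a c) (isUpperSet_openConn b c) _
    (fun ω => univ.filter (fun e => SepEdge (openGraph ω) c a e ∧ SepEdge (openGraph ω) c b e)) ?_
  rintro ω ⟨hac, hbc⟩
  obtain ⟨I, J, -, -, hIω, hJω, hiff⟩ := exists_open_paths_inter_edges_sepEdge (a := a) (b := b) (c := c) hac hbc
  refine ⟨{e | e ∈ I.edges}, {e | e ∈ J.edges}, reachable_openGraph_edges I, reachable_openGraph_edges J,
    fun e he => hIω e he, fun e he => hJω e he, ?_⟩
  rintro e ⟨heI, heJ⟩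
  exact Finset.mem_coe.2 (Finset.mem_filter.2 ⟨Finset.mem_univ _, (hiff e).1 ⟨heI, heJ⟩⟩)

/-- `Cov(1{a↔c},1{b↔c}) ≤ E[1{a↔c↔b} · (1 − ∏_{e∈Br(c|ab)} w_e)]`: the Gladkov–Zimin covariance is at most the expected
BRIDGE FRAGILITY of the `abc`-cluster (the probability that a resampling of the open `c|ab`-bridges closes one of them).
[cite: Gladkov2024, Thm. 8.2 and p. 14] [cite: GladkovZimin2024, §6] -/
theorem cov_le_integral_bridgeDefect (w : Sym2 V → unitInterval) (a b c : V) :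
    (prodBernoulli w).real ((openConn a c : Set (Set (Sym2 V))) ∩ (openConn b c : Set (Set (Sym2 V)))) -
        (prodBernoulli w).real (openConn a c) * (prodBernoulli w).real (openConn b c) ≤
      ∫ ω, ((openConn a c : Set (Set (Sym2 V))) ∩ (openConn b c : Set (Set (Sym2 V)))).indicator (fun _ => (1 : ℝ)) ω *
        (1 - ∏ e ∈ univ.filter (fun e => SepEdge (openGraph ω) c a e ∧ SepEdge (openGraph ω) c b e), (w e : ℝ))
        ∂(prodBernoulli w) := by
  set W : Set (Set (Sym2 V)) := (openConn a c : Set (Set (Sym2 V))) ∩ (openConn b c : Set (Set (Sym2 V))) with hW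
  set P : Set (Sym2 V) → ℝ := fun ω =>
    ∏ e ∈ univ.filter (fun e => SepEdge (openGraph ω) c a e ∧ SepEdge (openGraph ω) c b e), (w e : ℝ) with hP
  have hA := integral_bridgeProduct_le w a b c
  have hsplit : ∫ ω, W.indicator (fun _ => (1 : ℝ)) ω * (1 - P ω) ∂(prodBernoulli w) =
      ∫ ω, W.indicator (fun _ => (1 : ℝ)) ω ∂(prodBernoulli w) - ∫ ω, W.indicator (fun _ => (1 : ℝ)) ω * P ω ∂(prodBernoulli w) := by
    rw [← integral_sub (Integrable.of_finite) (Integrable.of_finite)]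
    refine integral_congr_ae (Filter.Eventually.of_forall fun ω => ?_)
    simp only
    ring
  have hind : ∫ ω, W.indicator (fun _ => (1 : ℝ)) ω ∂(prodBernoulli w) = (prodBernoulli w).real W :=
    integral_indicator_one (MeasurableSet.of_discrete (s := W))
  rw [hsplit, hind]
  linarith

/-- `1 − ∏ xᵢ ≤ ∑ (1 − xᵢ)` for numbers in `[0, 1]`. [folklore] -/
private theorem one_sub_prod_le_sum {ι : Type*} (s : Finset ι) (x : ι → ℝ) (h0 : ∀ i ∈ s, 0 ≤ x i)
    (h1 : ∀ i ∈ s, x i ≤ 1) : 1 - ∏ i ∈ s, x i ≤ ∑ i ∈ s, (1 - x i) := by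
  induction s using Finset.induction_on with
  | empty => simp
  | insert i s hi ih =>
    rw [Finset.prod_insert hi, Finset.sum_insert hi]
    have hs0 : 0 ≤ ∏ j ∈ s, x j := Finset.prod_nonneg fun j hj => h0 j (Finset.mem_insert_of_mem hj)
    have hs1 : ∏ j ∈ s, x j ≤ 1 := Finset.prod_le_one (fun j hj => h0 j (Finset.mem_insert_of_mem hj))
      fun j hj => h1 j (Finset.mem_insert_of_mem hj)
    have hi0 : 0 ≤ x i := h0 i (Finset.mem_insert_self i s)
    have hi1 : x i ≤ 1 := h1 i (Finset.mem_insert_self i s)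
    have ih' := ih (fun j hj => h0 j (Finset.mem_insert_of_mem hj)) fun j hj => h1 j (Finset.mem_insert_of_mem hj)
    nlinarith [mul_nonneg hi0 hs0, mul_nonneg (sub_nonneg.2 hi1) (sub_nonneg.2 hs1)]

/-- **`Cov(1{a↔c},1{b↔c}) ≤ P(a↔c↔b ∧ some open edge separates c from a and from b)`**: all of the (Harris-nonnegative)
correlation of the two connections to the hub `c` is carried by configurations in which `c` hangs off the `ab`-cluster
through an open bridge.  (Contrast Gladkov–Zimin Prop. 6.1: the covariance vanishes when `c` is a cut vertex between
`a` and `b`.) [cite: Gladkov2024, Thm. 8.2 and p. 14] [cite: GladkovZimin2024, §6 (Prop. 6.1)] -/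
theorem cov_le_real_exists_bridge (w : Sym2 V → unitInterval) (a b c : V) :
    (prodBernoulli w).real ((openConn a c : Set (Set (Sym2 V))) ∩ (openConn b c : Set (Set (Sym2 V)))) -
        (prodBernoulli w).real (openConn a c) * (prodBernoulli w).real (openConn b c) ≤
      (prodBernoulli w).real (((openConn a c : Set (Set (Sym2 V))) ∩ (openConn b c : Set (Set (Sym2 V)))) ∩
        {ω : Set (Sym2 V) | ∃ e, SepEdge (openGraph ω) c a e ∧ SepEdge (openGraph ω) c b e}) := by
  refine (cov_le_integral_bridgeDefect w a b c).trans ?_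
  rw [← integral_indicator_one (MeasurableSet.of_discrete
    (s := ((openConn a c : Set (Set (Sym2 V))) ∩ (openConn b c : Set (Set (Sym2 V)))) ∩
      {ω : Set (Sym2 V) | ∃ e, SepEdge (openGraph ω) c a e ∧ SepEdge (openGraph ω) c b e}))]
  refine integral_mono (Integrable.of_finite) (Integrable.of_finite) fun ω => ?_
  have hp0 : 0 ≤ ∏ e ∈ univ.filter (fun e => SepEdge (openGraph ω) c a e ∧ SepEdge (openGraph ω) c b e), (w e : ℝ) :=
    Finset.prod_nonneg fun e _ => (w e).2.1
  have hp1 : ∏ e ∈ univ.filter (fun e => SepEdge (openGraph ω) c a e ∧ SepEdge (openGraph ω) c b e), (w e : ℝ) ≤ 1 :=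
    Finset.prod_le_one (fun e _ => (w e).2.1) fun e _ => (w e).2.2
  by_cases hω : ω ∈ ((openConn a c : Set (Set (Sym2 V))) ∩ (openConn b c : Set (Set (Sym2 V))))
  · by_cases hex : ∃ e, SepEdge (openGraph ω) c a e ∧ SepEdge (openGraph ω) c b e
    · rw [Set.indicator_of_mem hω, Set.indicator_of_mem (show ω ∈ _ ∩ _ from ⟨hω, hex⟩)]
      simp only [Pi.one_apply, one_mul]
      linarith
    · have hempty : univ.filter (fun e => SepEdge (openGraph ω) c a e ∧ SepEdge (openGraph ω) c b e) = ∅ :=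
        Finset.filter_eq_empty_iff.2 fun e _ he => hex ⟨e, he⟩
      rw [Set.indicator_of_mem hω, hempty, Finset.prod_empty]
      simp only [sub_self, mul_zero]
      exact Set.indicator_nonneg (fun _ _ => zero_le_one) ω
  · rw [Set.indicator_of_notMem hω, zero_mul]
    exact Set.indicator_nonneg (fun _ _ => zero_le_one) ω

/-- **THEOREM A (bridge form)**: `Cov(1{a↔c},1{b↔c}) ≤ E[1{a↔c↔b} · ∑_{e ∈ Br(c|ab)} (1 − w_e)]` — the covariance is at most
the expected total closing-probability of the open `c|ab`-bridges (equivalently, by the one-edge flip, the expected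
`w`-mass of the closed contact edges between the cluster of `c` and the `ab`-cluster on `{a ↔ b, c ∉ C(a)}`).
[cite: Gladkov2024, Thm. 8.2 and p. 14] [cite: GladkovZimin2024, §6] -/
theorem cov_le_integral_bridgeSum (w : Sym2 V → unitInterval) (a b c : V) :
    (prodBernoulli w).real ((openConn a c : Set (Set (Sym2 V))) ∩ (openConn b c : Set (Set (Sym2 V)))) -
        (prodBernoulli w).real (openConn a c) * (prodBernoulli w).real (openConn b c) ≤
      ∫ ω, ((openConn a c : Set (Set (Sym2 V))) ∩ (openConn b c : Set (Set (Sym2 V)))).indicator (fun _ => (1 : ℝ)) ω *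
        (∑ e ∈ univ.filter (fun e => SepEdge (openGraph ω) c a e ∧ SepEdge (openGraph ω) c b e), (1 - (w e : ℝ)))
        ∂(prodBernoulli w) := by
  refine (cov_le_integral_bridgeDefect w a b c).trans ?_
  refine integral_mono (Integrable.of_finite) (Integrable.of_finite) fun ω => ?_
  refine mul_le_mul_of_nonneg_left ?_ (Set.indicator_nonneg (fun _ _ => zero_le_one) ω)
  exact one_sub_prod_le_sum _ _ (fun e _ => (w e).2.1) fun e _ => (w e).2.2

end GZBridge

end Summit.CriticalPhenomena.PercolationContinuityZ3.Theorems

end
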